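import Summits.Parity.GeneralizedHardyLittlewood.Theorems.GreenTaoLevelTwoGITwoCyclicInverseAveraging
import Summits.Parity.GeneralizedHardyLittlewood.Theorems.GreenTaoLevelTwoGITwoCyclicInverseBohrAveraging
import Mathlib.Analysis.SpecialFunctions.Complex.CircleAddChar

/-!
# Route `GreenTaoLevelTwo`, crux `GITwo` (stmt-Parity-21275), line `birth`, stub `stub_cyclicInverse`:
# the symmetry argument, front part (GT08a arXiv Lemma 46, displays (eq9.72) ⇒ (eq9.75'))

Forty-fourth helper file toward the XL stub `stub_cyclicInverse` (B. Green, T. Tao, *An inverse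
theorem for the Gowers `U³(G)` norm*, arXiv:math/0503014, Thm. 68 = PEMS 51 (2008) Thm. 12.8).
Block C12, the first third of the proof of arXiv Lemma 46, in sum form with `1`-bounded weights:

* `exists_translate_sq_sum_ge` — (eq9.72) ⇒ (eq9.74): from
  `κ N #B₁ ≤ Σ_{h∈B₁} |Σ_x b₂(x+h) b₃(x) e(−μ(h)x)|` (any finset `B₁`, `‖b₂‖,‖b₃‖ ≤ 1`) and a nonempty
  finset `B₂`, some translate `x₁` has
  `κ² #B₁ #B₂² ≤ Σ_{h∈B₁} |Σ_{x∈B₂} b₂(x+x₁+h) b₃(x+x₁) e(−μ(h)x)|²`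
  (phase choice, arXiv Lemma 20 `exists_translate_norm_sum_ge`, arXiv Lemma 22
  `norm_sum_mul_sum_sq_le`);
The next step (eq9.74) ⇒ (eq9.75') (substitution `z = x+y+h`, arXiv Lemma 21 (i)
`norm_sum_shift_sub_sum_le_of_regular`, local additivity of `μ`, pigeonhole in `z`) is the remaining
piece of arXiv Lemma 46 between this file and `exists_popular_difference` (`…SymmetryPopular`) /
`symmetry_endgame` (`…SymmetryEndgame`).

References: [GreenTao2008U3Inverse] arXiv:math/0503014, Lemma 46 (first part of the proof).
-/

noncomputable section

namespace Summit.Parity.GeneralizedHardyLittlewood.GreenTaoLevelTwoGITwoCyclicInverse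

open Finset ZMod
open scoped ComplexConjugate

open Literature.NumberTheory.Sieve

variable {N : ℕ} [NeZero N]

/-- **(eq9.72) ⇒ (eq9.74) of GT08a arXiv Lemma 46.**  For finsets `B₁, B₂ ⊆ ℤ/Nℤ` (`B₂` nonempty),
`μ : ℤ/Nℤ → ℤ/Nℤ`, arbitrary weights `b₂, b₃` and `κ ≥ 0` with
`κ N #B₁ ≤ Σ_{h∈B₁} |Σ_x b₂(x+h) b₃(x) e(−μ(h)x/N)|`, some `x₁` satisfies
`κ² #B₁ #B₂² ≤ Σ_{h∈B₁} |Σ_{x∈B₂} b₂(x+x₁+h) b₃(x+x₁) e(−μ(h)x/N)|²`.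
[cite: GreenTao2008U3Inverse, Lemma 46 (displays (eq9.72)–(eq9.74))] -/
theorem exists_translate_sq_sum_ge (B₁ B₂ : Finset (ZMod N)) (hB₂ : B₂.Nonempty)
    (μ : ZMod N → ZMod N) (b₂ b₃ : ZMod N → ℂ) {κ : ℝ} (hκ : 0 ≤ κ)
    (hbig : κ * N * #B₁ ≤
      ∑ h ∈ B₁, ‖∑ x : ZMod N, b₂ (x + h) * b₃ x * stdAddChar (-(μ h * x))‖) :
    ∃ x₁ : ZMod N, κ ^ 2 * #B₁ * (#B₂ : ℝ) ^ 2 ≤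
      ∑ h ∈ B₁, ‖∑ x ∈ B₂, b₂ (x + x₁ + h) * b₃ (x + x₁) * stdAddChar (-(μ h * x))‖ ^ 2 := by
  classical
  have hNpos : (0 : ℝ) < N := by exact_mod_cast Nat.pos_of_ne_zero (NeZero.ne N)
  have hc0 : (0 : ℝ) < #B₂ := by exact_mod_cast hB₂.card_pos
  -- Step 1: the phases `b₁(h)`
  set I : ZMod N → ℂ := fun h => ∑ x : ZMod N, b₂ (x + h) * b₃ x * stdAddChar (-(μ h * x)) with hI
  set b₁ : ZMod N → ℂ := fun h => if I h = 0 then 0 else conj (I h) / (‖I h‖ : ℂ) with hb₁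
  have hb₁1 : ∀ h, ‖b₁ h‖ ≤ 1 := fun h => by
    rw [hb₁]; simp only
    split_ifs with h0
    · simp
    · rw [norm_div, Complex.norm_conj, Complex.norm_real, Real.norm_eq_abs, abs_of_nonneg
        (norm_nonneg _), div_self (norm_ne_zero_iff.mpr h0)]
  have hb₁I : ∀ h, b₁ h * I h = (‖I h‖ : ℂ) := fun h => by
    rw [hb₁]; simp only
    split_ifs with h0
    · rw [h0]; simp
    · have hne : (‖I h‖ : ℂ) ≠ 0 := by exact_mod_cast norm_ne_zero_iff.mpr h0
      rw [div_mul_eq_mul_div, div_eq_iff hne, mul_comm (conj (I h)), Complex.mul_conj,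
        Complex.normSq_eq_norm_sq]
      push_cast; ring
  -- Step 2: the global sum `Σ_x g(x) = Σ_h ‖I h‖`
  set g : ZMod N → ℂ := fun x => ∑ h ∈ B₁, b₁ h * (b₂ (x + h) * b₃ x * stdAddChar (-(μ h * x)))
    with hg
  have hsumg : ∑ x : ZMod N, g x = ∑ h ∈ B₁, (‖I h‖ : ℂ) := by
    rw [hg]
    simp only
    rw [Finset.sum_comm]
    refine sum_congr rfl fun h _ => ?_
    rw [← mul_sum, hb₁I]
  have hnormg : κ * N * #B₁ ≤ ‖∑ x : ZMod N, g x‖ := by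
    rw [hsumg]
    have : ((∑ h ∈ B₁, ‖I h‖ : ℝ) : ℂ) = ∑ h ∈ B₁, (‖I h‖ : ℂ) := by push_cast; rfl
    rw [← this, Complex.norm_real, Real.norm_eq_abs,
      abs_of_nonneg (sum_nonneg fun _ _ => norm_nonneg _)]
    exact hbig
  obtain ⟨x₁, hx₁⟩ := exists_translate_norm_sum_ge B₂ g
  -- `‖Σ_{x∈B₂} g(x+x₁)‖ ≥ κ #B₁ #B₂`
  have hloc : κ * #B₁ * #B₂ ≤ ‖∑ x ∈ B₂, g (x + x₁)‖ := by
    have h1 : (#B₂ : ℝ) * (κ * N * #B₁) ≤ N * ‖∑ x ∈ B₂, g (x + x₁)‖ :=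
      (mul_le_mul_of_nonneg_left hnormg hc0.le).trans hx₁
    have h2 : (N : ℝ) * (κ * #B₁ * #B₂) ≤ N * ‖∑ x ∈ B₂, g (x + x₁)‖ := by
      calc (N : ℝ) * (κ * #B₁ * #B₂) = #B₂ * (κ * N * #B₁) := by ring
        _ ≤ _ := h1
    exact le_of_mul_le_mul_left h2 hNpos
  -- rewrite `Σ_{x∈B₂} g(x + x₁)` as `Σ_{h∈B₁} b₁'(h) Σ_{x∈B₂} F h x`
  have hrew : ∑ x ∈ B₂, g (x + x₁) = ∑ h ∈ B₁, (b₁ h * stdAddChar (-(μ h * x₁))) *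
      ∑ x ∈ B₂, b₂ (x + x₁ + h) * b₃ (x + x₁) * stdAddChar (-(μ h * x)) := by
    rw [hg]
    simp only
    rw [Finset.sum_comm]
    refine sum_congr rfl fun h _ => ?_
    rw [mul_sum]
    refine sum_congr rfl fun x _ => ?_
    have : (stdAddChar (-(μ h * (x + x₁))) : ℂ) = stdAddChar (-(μ h * x₁)) * stdAddChar (-(μ h * x)) := by
      rw [← AddChar.map_add_eq_mul]; congr 1; ring
    rw [this]; ring
  rw [hrew] at hloc
  -- Step 3: Cauchy–Schwarz in `h`
  have hCS := norm_sum_mul_sum_sq_le B₁ B₂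
    (fun h x => b₂ (x + x₁ + h) * b₃ (x + x₁) * stdAddChar (-(μ h * x)))
    (fun h => b₁ h * stdAddChar (-(μ h * x₁))) (fun h _ => by
      rw [norm_mul, norm_stdAddChar, mul_one]; exact hb₁1 h)
  refine ⟨x₁, ?_⟩
  have h3 := pow_le_pow_left₀ (by positivity) hloc 2
  rcases Nat.eq_zero_or_pos #B₁ with h0 | hpos
  · have : B₁ = ∅ := card_eq_zero.mp h0
    subst this
    simp
  · have hB₁pos : (0 : ℝ) < #B₁ := by exact_mod_cast hpos
    have h4 : (κ * #B₁ * #B₂) ^ 2 ≤ #B₁ * ∑ h ∈ B₁,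
        ‖∑ x ∈ B₂, b₂ (x + x₁ + h) * b₃ (x + x₁) * stdAddChar (-(μ h * x))‖ ^ 2 := h3.trans hCS
    have h5 : (#B₁ : ℝ) * (κ ^ 2 * #B₁ * (#B₂ : ℝ) ^ 2) ≤ #B₁ * ∑ h ∈ B₁,
        ‖∑ x ∈ B₂, b₂ (x + x₁ + h) * b₃ (x + x₁) * stdAddChar (-(μ h * x))‖ ^ 2 := by
      calc (#B₁ : ℝ) * (κ ^ 2 * #B₁ * (#B₂ : ℝ) ^ 2) = (κ * #B₁ * #B₂) ^ 2 := by ring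
        _ ≤ _ := h4
    exact le_of_mul_le_mul_left h5 hB₁pos

end Summit.Parity.GeneralizedHardyLittlewood.GreenTaoLevelTwoGITwoCyclicInverse
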